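import Summits.QuantumFields.YangMills.Theorems.PoincareLipschitzWenteOneCentreLetters
import Summits.QuantumFields.YangMills.Theorems.PoincareLipschitzCircleWirtinger
import Summits.QuantumFields.YangMills.Theorems.PoincareLipschitzWeakJacobianIdentity
import Literature.Analysis.FunctionSpaces.SpaceTimeWeakCompactness
import HarnessLib

/-!
# Crux `BlockLipschitzL` (stmt-QuantumFields-23533) ∕ `HistoryTailL` (stmt-QuantumFields-19936), LINE 25, stub S1″ — ROAD (W)
# «the H-system gap at 3π», brick W-ONE «WENTE ONE-CENTRE LEMMA», file 3: THE ANNULAR BOUND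

Cell `ym3-torus` (YM ladder rung R3 = continuum SU(2) Yang–Mills on T³ — a RUNG, NOT Clay: not d = 4, not infinite volume,
not a mass gap); TWIN-WIDTH helper seat `ym-ust-19936-w7` g15; `--supports stmt-QuantumFields-19936`; THEOREMS ONLY (0 `def`,
0 `sorry`, default heartbeats); imports file 1 (radial letters), px6 g10's ✓`PoincareLipschitzCircleWirtinger` (★★
`abs_integral_radialWeight_mul_fderiv_perp_le`: the SMOOTH weighted annular Wirtinger pairing bound), px19 g8's
✓`PoincareLipschitzWeakJacobianIdentity` (§1 `W^{1,2} ⇒ L²` convergence of derivatives, §3 `L² × L² → L¹` letters), lit ✓`MeyersSerrinProofs`.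

★★★ `abs_integral_radialWeight_mul_weakGrad_perp_le` — THE ANNULAR BOUND AT THE SOBOLEV LEVEL (`s = ‖y − x₀‖²`,
`A = {ρ₀ < ‖y − x₀‖ < ρ₁}`): for `a, b ∈ W^{1,2}_loc(E²)` and a continuous radial weight `κ` supported in `ρ₀² < s < ρ₁²` with
`|κ(s)|·s ≤ 1`: `|∫ κ(s)·a·Gb[perp(y − x₀)]| ≤ √(∫_A ‖Ga‖²)·√(∫_A ‖Gb‖²)` — Meyers–Serrin on `{ρ₀∕2 < ‖y − x₀‖ < 2ρ₁}`, a smooth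
cut-off `= 1` near `Ā`, px6's smooth bound, `L² × L²` limits (first in `b`, then in `a`).  With file 2's ★★★`annularAverage_sub_eq`
this is memo §2's boxed bound `|𝒜_{r₀}u − 𝒜_{r₁}u| ≤ π⁻¹‖∇a‖_{L²(A)}‖∇b‖_{L²(A)}` (ROAD (W) memo `ROAD-W-WENTE-3PI-w3g16.md`).
HONEST SCOPE.  Sobolev calculus; nothing of (W-OSC), (GAP), (TM), S1″, K1, `MeanDeviationL`, `BlockLipschitzL`, `HistoryTailL` is proved
here.  YM₃ on T³ is rung R3, not Clay; YM gap NOT proved; no summit statement is proved here.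
References: H. Wente (1969); [BrezisCoron1985] Lemma A.1; [Helein2002] §3.1; [Topping1997]; [MeyersSerrin1964]. -/

set_option autoImplicit false

noncomputable section
open MeasureTheory Set Function Filter Topology Metric TopologicalSpace
open scoped ContDiff ENNReal BigOperators RealInnerProductSpace
namespace Summit.QuantumFields.YangMills.Theorems.PoincareLipschitzWenteOneCentreBound

open Literature.Analysis.FunctionSpaces
open Literature.Analysis.FluidPDE (perp)
open Summit.QuantumFields.YangMills.Theorems.PoincareLipschitzWenteOneCentreLetters (apply_perp_eq)
open Summit.QuantumFields.YangMills.Theorems.PoincareLipschitzCircleWirtinger (abs_integral_radialWeight_mul_fderiv_perp_le)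
open Summit.QuantumFields.YangMills.Theorems.PoincareLipschitzWeakJacobianIdentity
  (tendsto_eLpNorm_fderiv_of_tendsto_eSobolevDomainNorm integrable_mul_of_L2 tendsto_integral_mul_of_L2
    tendsto_integral_mul_sub_mul_of_L2)

/-! ## §1 Letters -/
/-- `‖L‖² = (L e₀)² + (L e₁)²` for a linear functional on the plane (Riesz). [folklore] -/
theorem opNorm_sq_eq_sum_sq (L : EuclideanSpace ℝ (Fin 2) →L[ℝ] ℝ) :
    ‖L‖ ^ 2 = ∑ k : Fin 2, (L (EuclideanSpace.single k (1:ℝ))) ^ 2 := by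
  set v := (InnerProductSpace.toDual ℝ (EuclideanSpace ℝ (Fin 2))).symm L with hv
  have hL : L = InnerProductSpace.toDual ℝ (EuclideanSpace ℝ (Fin 2)) v := by rw [hv, LinearIsometryEquiv.apply_symm_apply]
  have hnorm : ‖L‖ = ‖v‖ := by rw [hL, LinearIsometryEquiv.norm_map]
  have happ : ∀ k : Fin 2, L (EuclideanSpace.single k (1:ℝ)) = v k := by
    intro k
    rw [hL, InnerProductSpace.toDual_apply_apply, EuclideanSpace.inner_single_right]
    simp
  simp_rw [hnorm, happ, EuclideanSpace.norm_eq, Real.sq_sqrt (Finset.sum_nonneg fun _ _ => sq_nonneg _), Real.norm_eq_abs,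
    sq_abs]

/-- A cut-off product: `θ` smooth with `tsupport θ ⊆ Ω′` (open) and `f` smooth on `Ω′` give a globally smooth `θ·f`. [folklore] -/
theorem contDiff_cutoff_mul {Ω' : Set (EuclideanSpace ℝ (Fin 2))} (hΩ' : IsOpen Ω') {θ f : EuclideanSpace ℝ (Fin 2) → ℝ}
    (hθ : ContDiff ℝ ∞ θ) (hθs : tsupport θ ⊆ Ω') (hf : ContDiffOn ℝ ∞ f Ω') :
    ContDiff ℝ 1 (fun y => θ y * f y) := by
  refine contDiff_iff_contDiffAt.2 fun y => ?_
  by_cases hy : y ∈ Ω'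
  · exact ((hθ.of_le (by simp)).contDiffAt).mul ((hf.of_le (by simp)).contDiffAt (hΩ'.mem_nhds hy))
  · have hy' : y ∉ tsupport θ := fun h => hy (hθs h)
    have hev : (fun y => θ y * f y) =ᶠ[𝓝 y] fun _ => 0 := by
      filter_upwards [(notMem_tsupport_iff_eventuallyEq.1 hy')] with z hz
      rw [hz, Pi.zero_apply, zero_mul]
    exact (contDiffAt_const (c := (0:ℝ))).congr_of_eventuallyEq hev

section L2
variable {α : Type*} [MeasurableSpace α] {ν : Measure α}
/-- `‖·‖²` convergence from `L²` convergence: `∫ (bsₙ)² → ∫ b²` when `bsₙ → b` in `L²` (via `x_n² − x² = (x_n − x)² + 2x(x_n − x)`).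
[folklore] -/
theorem tendsto_integral_sq_of_L2 {b : α → ℝ} {bs : ℕ → α → ℝ} (hb : MemLp b 2 ν) (hbs : ∀ n, AEStronglyMeasurable (bs n) ν)
    (hlim : Tendsto (fun n => eLpNorm (fun x => b x - bs n x) 2 ν) atTop (𝓝 0)) :
    Tendsto (fun n => ∫ x, bs n x ^ 2 ∂ν) atTop (𝓝 (∫ x, b x ^ 2 ∂ν)) := by
  -- eventually `bs n ∈ L²`
  have hev : ∀ᶠ n in atTop, MemLp (bs n) 2 ν := by
    have h1 : ∀ᶠ n in atTop, eLpNorm (fun x => b x - bs n x) 2 ν < 1 := (tendsto_order.1 hlim).2 1 zero_lt_one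
    filter_upwards [h1] with n hn
    have hd : MemLp (fun x => b x - bs n x) 2 ν := ⟨hb.1.sub (hbs n), hn.trans ENNReal.one_lt_top⟩
    exact (hb.sub hd).congr_norm (hbs n) (Filter.Eventually.of_forall fun x => by simp)
  -- the square of the `L²` distance tends to `0`
  have hsq : Tendsto (fun n => ∫ x, (b x - bs n x) ^ 2 ∂ν) atTop (𝓝 0) := by
    have h2 : ∀ n, ∫ x, (b x - bs n x) ^ 2 ∂ν = (eLpNorm (fun x => b x - bs n x) 2 ν ^ 2).toReal := by
      intro n
      rw [eLpNorm_two_pow_two_eq_lintegral, integral_eq_lintegral_of_nonneg_ae (f := fun x => (b x - bs n x) ^ 2)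
        (Filter.Eventually.of_forall fun x => sq_nonneg _) ((hb.1.sub (hbs n)).pow 2)]
      congr 1
      refine lintegral_congr fun x => ?_
      rw [Real.enorm_eq_ofReal_abs, ← ENNReal.ofReal_pow (abs_nonneg _), sq_abs]
    simp_rw [h2, ENNReal.toReal_pow]
    have h0 : Tendsto (fun n => (eLpNorm (fun x => b x - bs n x) 2 ν).toReal) atTop (𝓝 0) := by
      have := (ENNReal.tendsto_toReal ENNReal.zero_ne_top).comp hlim
      simpa [Function.comp_def] using this
    simpa using h0.pow 2
  -- the cross term tends to `0`
  obtain ⟨hi, hcross⟩ := tendsto_integral_mul_of_L2 (ν := ν) hb hb hbs hlim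
  -- assemble
  have hid : ∀ᶠ n in atTop, ∫ x, bs n x ^ 2 ∂ν = ∫ x, b x ^ 2 ∂ν + ∫ x, (b x - bs n x) ^ 2 ∂ν -
      2 * (∫ x, b x * b x ∂ν - ∫ x, b x * bs n x ∂ν) := by
    filter_upwards [hev, hi] with n hn hin
    have hb2 : Integrable (fun x => b x ^ 2) ν := (memLp_two_iff_integrable_sq hb.1).1 hb
    have hbs2 : Integrable (fun x => bs n x ^ 2) ν := (memLp_two_iff_integrable_sq (hbs n)).1 hn
    have hbb : Integrable (fun x => b x * b x) ν := integrable_mul_of_L2 hb hb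
    have hd2 : Integrable (fun x => (b x - bs n x) ^ 2) ν := by
      have : (fun x => (b x - bs n x) ^ 2) = fun x => b x ^ 2 + bs n x ^ 2 - 2 * (b x * bs n x) := by
        funext x; ring
      rw [this]
      exact (hb2.fun_add hbs2).sub' (hin.const_mul 2)
    have key : ∫ x, (b x - bs n x) ^ 2 ∂ν = ∫ x, b x ^ 2 ∂ν + ∫ x, bs n x ^ 2 ∂ν - 2 * ∫ x, b x * bs n x ∂ν := by
      have h1 : ∫ x, (b x - bs n x) ^ 2 ∂ν = ∫ x, ((b x ^ 2 + bs n x ^ 2) - 2 * (b x * bs n x)) ∂ν :=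
        integral_congr_ae (Filter.Eventually.of_forall fun x => by simp only; ring)
      rw [h1, integral_sub (hb2.fun_add hbs2) (hin.const_mul 2), integral_add hb2 hbs2, integral_const_mul]
    have hbb' : ∫ x, b x * b x ∂ν = ∫ x, b x ^ 2 ∂ν := integral_congr_ae (Filter.Eventually.of_forall fun x => by
      simp only; ring)
    rw [key, hbb']
    ring
  have hlimit : Tendsto (fun n => ∫ x, b x ^ 2 ∂ν + ∫ x, (b x - bs n x) ^ 2 ∂ν -
      2 * (∫ x, b x * b x ∂ν - ∫ x, b x * bs n x ∂ν)) atTop (𝓝 (∫ x, b x ^ 2 ∂ν)) := by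
    have h1 := (tendsto_const_nhds (x := ∫ x, b x ^ 2 ∂ν)).add hsq
    have h2 := ((tendsto_const_nhds (x := ∫ x, b x * b x ∂ν)).sub hcross).const_mul 2
    have := h1.sub h2
    simpa using this
  exact hlimit.congr' (hid.mono fun n hn => hn.symm)
end L2

/-! ## §2 The annular bound at the Sobolev level -/

/-- ★★★ **THE ANNULAR BOUND (Sobolev level).**  Let `a, b` have weak gradients `Ga, Gb` on the plane with `a, b, ‖Ga‖, ‖Gb‖`
locally square-integrable, let `0 < ρ₀ ≤ ρ₁`, and let `κ : ℝ → ℝ` be continuous with `|κ(s)|·s ≤ 1` (`s > 0`) and `κ(s) = 0`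
unless `ρ₀² < s < ρ₁²`.  Then
`|∫ κ(‖y − x₀‖²)·a(y)·Gb y (perp (y − x₀)) dy| ≤ √(∫_A ‖Ga‖²)·√(∫_A ‖Gb‖²)`, `A = {ρ₀ < ‖y − x₀‖ < ρ₁}` —
the Sobolev form of the sharp Wente one-centre estimate (Meyers–Serrin + cut-off + px6's smooth weighted Wirtinger bound +
`L² × L²` limits). [cite: Helein2002, §3.1 (Wente's lemma by polar coordinates); Topping1997, Theorem 1 (sharp constant); MeyersSerrin1964, Theorem] -/
theorem abs_integral_radialWeight_mul_weakGrad_perp_le (x₀ : EuclideanSpace ℝ (Fin 2))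
    {a b : EuclideanSpace ℝ (Fin 2) → ℝ} {Ga Gb : EuclideanSpace ℝ (Fin 2) → EuclideanSpace ℝ (Fin 2) →L[ℝ] ℝ}
    (ha : HasWeakFDerivOn (⟨univ, isOpen_univ⟩ : Opens (EuclideanSpace ℝ (Fin 2))) volume a Ga)
    (hb : HasWeakFDerivOn (⟨univ, isOpen_univ⟩ : Opens (EuclideanSpace ℝ (Fin 2))) volume b Gb)
    (ha2 : LocallyIntegrable (fun y => a y ^ 2) volume) (hb2 : LocallyIntegrable (fun y => b y ^ 2) volume)
    (hGa2 : LocallyIntegrable (fun y => ‖Ga y‖ ^ 2) volume) (hGb2 : LocallyIntegrable (fun y => ‖Gb y‖ ^ 2) volume)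
    {κ : ℝ → ℝ} (hκc : Continuous κ) (hκ1 : ∀ s, 0 < s → |κ s| * s ≤ 1)
    {ρ₀ ρ₁ : ℝ} (hρ₀ : 0 < ρ₀) (hρ : ρ₀ ≤ ρ₁) (hκ0 : ∀ s, (s ≤ ρ₀ ^ 2 ∨ ρ₁ ^ 2 ≤ s) → κ s = 0) :
    |∫ y, κ (‖y - x₀‖ ^ 2) * a y * Gb y (perp (y - x₀))| ≤
      Real.sqrt (∫ y in {y | ρ₀ < ‖y - x₀‖ ∧ ‖y - x₀‖ < ρ₁}, ‖Ga y‖ ^ 2) *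
        Real.sqrt (∫ y in {y | ρ₀ < ‖y - x₀‖ ∧ ‖y - x₀‖ < ρ₁}, ‖Gb y‖ ^ 2) := by
  set A : Set (EuclideanSpace ℝ (Fin 2)) := {y | ρ₀ < ‖y - x₀‖ ∧ ‖y - x₀‖ < ρ₁} with hA
  set K : Set (EuclideanSpace ℝ (Fin 2)) := {y | ρ₀ ≤ ‖y - x₀‖ ∧ ‖y - x₀‖ ≤ ρ₁} with hK
  set Ωs : Set (EuclideanSpace ℝ (Fin 2)) := {y | ρ₀ / 2 < ‖y - x₀‖ ∧ ‖y - x₀‖ < 2 * ρ₁} with hΩs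
  have hρ₁ : 0 < ρ₁ := hρ₀.trans_le hρ
  have hnc : Continuous fun y : EuclideanSpace ℝ (Fin 2) => ‖y - x₀‖ := (continuous_id.sub continuous_const).norm
  have hAo : IsOpen A := isOpen_Ioo.preimage hnc
  have hΩo : IsOpen Ωs := isOpen_Ioo.preimage hnc
  have hKcl : IsClosed K := isClosed_Icc.preimage hnc
  have hKC : K ⊆ closedBall x₀ ρ₁ := fun y hy => by rw [mem_closedBall, dist_eq_norm]; exact hy.2
  have hKc : IsCompact K := (isCompact_closedBall x₀ ρ₁).of_isClosed_subset hKcl hKC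
  have hAK : A ⊆ K := fun y hy => ⟨hy.1.le, hy.2.le⟩
  have hKΩ : K ⊆ Ωs := fun y hy => ⟨by linarith [hy.1], by linarith [hy.2]⟩
  have hAΩ : A ⊆ Ωs := hAK.trans hKΩ
  have hΩC : Ωs ⊆ closedBall x₀ (2 * ρ₁) := fun y hy => by rw [mem_closedBall, dist_eq_norm]; exact hy.2.le
  have hCc : IsCompact (closedBall x₀ (2 * ρ₁)) := isCompact_closedBall _ _
  set Ω' : Opens (EuclideanSpace ℝ (Fin 2)) := ⟨Ωs, hΩo⟩ with hΩ'
  have hΩ'le : Ω' ≤ (⟨univ, isOpen_univ⟩ : Opens (EuclideanSpace ℝ (Fin 2))) := fun _ _ => trivial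
  have hΩm : MeasurableSet (Ω' : Set (EuclideanSpace ℝ (Fin 2))) := hΩo.measurableSet
  have hAm : MeasurableSet A := hAo.measurableSet
  set ν : Measure (EuclideanSpace ℝ (Fin 2)) := volume.restrict (Ω' : Set (EuclideanSpace ℝ (Fin 2))) with hν
  set νA : Measure (EuclideanSpace ℝ (Fin 2)) := volume.restrict A with hνA
  have hνA_le : νA ≤ ν := Measure.restrict_mono hAΩ le_rfl
  -- (1) `L²(Ω')` letters
  have hL2 : ∀ {h : EuclideanSpace ℝ (Fin 2) → ℝ}, LocallyIntegrable h volume →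
      LocallyIntegrable (fun x => h x ^ 2) volume → MemLp h 2 ν := by
    intro h hh hh2
    have hm : AEStronglyMeasurable h ν := ((hh.integrableOn_isCompact hCc).mono_set hΩC).aestronglyMeasurable
    exact (memLp_two_iff_integrable_sq hm).2 ((hh2.integrableOn_isCompact hCc).mono_set hΩC)
  have hGL2 : ∀ {h : EuclideanSpace ℝ (Fin 2) → ℝ} {G : EuclideanSpace ℝ (Fin 2) → EuclideanSpace ℝ (Fin 2) →L[ℝ] ℝ},
      HasWeakFDerivOn (⟨univ, isOpen_univ⟩ : Opens (EuclideanSpace ℝ (Fin 2))) volume h G →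
      LocallyIntegrable (fun x => ‖G x‖ ^ 2) volume → ∀ w, MemLp (fun x => G x w) 2 ν := by
    intro h G hh hG2 w
    have hGl : LocallyIntegrable G volume := by
      have := hh.locallyIntegrableOn_deriv; simpa [locallyIntegrableOn_univ] using this
    have hm : AEStronglyMeasurable G ν := ((hGl.integrableOn_isCompact hCc).mono_set hΩC).aestronglyMeasurable
    have hG : MemLp G 2 ν := (memLp_two_iff_integrable_sq_norm hm).2 ((hG2.integrableOn_isCompact hCc).mono_set hΩC)
    exact (ContinuousLinearMap.apply ℝ ℝ w).comp_memLp' hG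
  have hal : LocallyIntegrable a volume := by
    have := ha.locallyIntegrableOn; simpa [locallyIntegrableOn_univ] using this
  have hbl : LocallyIntegrable b volume := by
    have := hb.locallyIntegrableOn; simpa [locallyIntegrableOn_univ] using this
  have haL2 : MemLp a 2 ν := hL2 hal ha2
  have hGaL2 : ∀ w, MemLp (fun x => Ga x w) 2 ν := hGL2 ha hGa2
  have hGbL2 : ∀ w, MemLp (fun x => Gb x w) 2 ν := hGL2 hb hGb2
  have ha' : HasWeakFDerivOn Ω' volume a Ga := HasWeakFDerivOn.mono_set_holds ha hΩ'le
  have hb' : HasWeakFDerivOn Ω' volume b Gb := HasWeakFDerivOn.mono_set_holds hb hΩ'le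
  -- (2) Meyers–Serrin on `Ω'`
  have hmem : ∀ {h : EuclideanSpace ℝ (Fin 2) → ℝ} {G : EuclideanSpace ℝ (Fin 2) → EuclideanSpace ℝ (Fin 2) →L[ℝ] ℝ},
      HasWeakFDerivOn Ω' volume h G → MemLp h 2 ν → (∀ w, MemLp (fun x => G x w) 2 ν) → MemSobolevDomain 1 2 Ω' volume h := by
    intro h G hh hh2 hG2
    rw [memSobolevDomain_succ_iff]
    refine ⟨hh2, G, hh, fun w => ?_⟩
    rw [memSobolevDomain_zero_iff]
    exact hG2 w
  obtain ⟨t, ht, htlim⟩ := MeyersSerrin.exists_contDiffOn_tendsto_eSobolevDomainNorm_sub (Ω := Ω') (μ := volume)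
    (p := 2) (by norm_num) ENNReal.ofNat_ne_top (hmem ha' haL2 hGaL2)
  obtain ⟨s, hs, hslim⟩ := MeyersSerrin.exists_contDiffOn_tendsto_eSobolevDomainNorm_sub (Ω := Ω') (μ := volume)
    (p := 2) (by norm_num) ENNReal.ofNat_ne_top (hmem hb' (hL2 hbl hb2) hGbL2)
  have hDa : ∀ w, Tendsto (fun m => eLpNorm (fun x => Ga x w - fderiv ℝ (t m) x w) 2 ν) atTop (𝓝 0) :=
    fun w => tendsto_eLpNorm_fderiv_of_tendsto_eSobolevDomainNorm ha' ht htlim (by norm_num) w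
  have hDb : ∀ w, Tendsto (fun n => eLpNorm (fun x => Gb x w - fderiv ℝ (s n) x w) 2 ν) atTop (𝓝 0) :=
    fun w => tendsto_eLpNorm_fderiv_of_tendsto_eSobolevDomainNorm hb' hs hslim (by norm_num) w
  have hta : Tendsto (fun m => eLpNorm (fun x => a x - t m x) 2 ν) atTop (𝓝 0) := by
    have hle : ∀ m, eLpNorm (fun x => a x - t m x) 2 ν ≤ eSobolevDomainNorm 1 2 Ω' volume (a - t m) :=
      fun m => eLpNorm_le_eSobolevDomainNorm
    exact tendsto_of_tendsto_of_tendsto_of_le_of_le tendsto_const_nhds htlim (fun _ => bot_le) hle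
  have htm : ∀ m, AEStronglyMeasurable (t m) ν := fun m => ((ht m).continuousOn).aestronglyMeasurable hΩm
  have hsm : ∀ n w, AEStronglyMeasurable (fun x => fderiv ℝ (s n) x w) ν := fun n w =>
    (((hs n).continuousOn_fderiv_of_isOpen hΩo (by simp)).clm_apply continuousOn_const).aestronglyMeasurable hΩm
  have htm' : ∀ m w, AEStronglyMeasurable (fun x => fderiv ℝ (t m) x w) ν := fun m w =>
    (((ht m).continuousOn_fderiv_of_isOpen hΩo (by simp)).clm_apply continuousOn_const).aestronglyMeasurable hΩm
  -- eventually `t m ∈ L²(ν)`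
  have htev : ∀ᶠ m in atTop, MemLp (t m) 2 ν := by
    have h1 : ∀ᶠ m in atTop, eLpNorm (fun x => a x - t m x) 2 ν < 1 := (tendsto_order.1 hta).2 1 zero_lt_one
    filter_upwards [h1] with m hm
    have hd : MemLp (fun x => a x - t m x) 2 ν := ⟨haL2.1.sub (htm m), hm.trans ENNReal.one_lt_top⟩
    exact (haL2.sub hd).congr_norm (htm m) (Filter.Eventually.of_forall fun x => by
      simp only [Pi.sub_apply, sub_sub_cancel])
  -- (3) the cut-off and the global `C¹` approximants
  obtain ⟨θ, hθ, -, hθs, hθ1⟩ := MeyersSerrin.exists_smooth_cutoff hKc hΩo hKΩ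
  obtain ⟨V, hVo, hKV, hV1⟩ := mem_nhdsSet_iff_exists.1 hθ1
  have hAV : A ⊆ V := hAK.trans hKV
  have hT : ∀ m, ContDiff ℝ 1 (fun y => θ y * t m y) := fun m => contDiff_cutoff_mul hΩo hθ hθs (ht m)
  have hS : ∀ n, ContDiff ℝ 1 (fun y => θ y * s n y) := fun n => contDiff_cutoff_mul hΩo hθ hθs (hs n)
  have hfdT : ∀ m, ∀ y ∈ V, fderiv ℝ (fun y => θ y * t m y) y = fderiv ℝ (t m) y := by
    intro m y hy
    refine Filter.EventuallyEq.fderiv_eq ?_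
    filter_upwards [hVo.mem_nhds hy] with z hz
    rw [show θ z = 1 from hV1 hz, one_mul]
  have hfdS : ∀ n, ∀ y ∈ V, fderiv ℝ (fun y => θ y * s n y) y = fderiv ℝ (s n) y := by
    intro n y hy
    refine Filter.EventuallyEq.fderiv_eq ?_
    filter_upwards [hVo.mem_nhds hy] with z hz
    rw [show θ z = 1 from hV1 hz, one_mul]
  have hκA : ∀ y, κ (‖y - x₀‖ ^ 2) ≠ 0 → y ∈ A := by
    intro y hy
    by_contra hyA
    apply hy; apply hκ0
    by_contra hcon
    simp only [not_or, not_le] at hcon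
    apply hyA
    refine ⟨?_, ?_⟩
    · nlinarith [hcon.1, norm_nonneg (y - x₀), hρ₀]
    · nlinarith [hcon.2, norm_nonneg (y - x₀), hρ₁]
  have hκbd : ∀ y (k : Fin 2), |κ (‖y - x₀‖ ^ 2) * (y - x₀) k| ≤ ρ₀⁻¹ := by
    intro y k
    by_cases hy : κ (‖y - x₀‖ ^ 2) = 0
    · rw [hy, zero_mul, abs_zero]; positivity
    · have hyA := hκA y hy
      have hn : 0 < ‖y - x₀‖ := hρ₀.trans hyA.1
      have hk : |(y - x₀) k| ≤ ‖y - x₀‖ := by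
        have := PiLp.norm_apply_le (y - x₀) k
        rwa [Real.norm_eq_abs] at this
      have h1 := hκ1 _ (by positivity : 0 < ‖y - x₀‖ ^ 2)
      rw [abs_mul]
      calc |κ (‖y - x₀‖ ^ 2)| * |(y - x₀) k| ≤ |κ (‖y - x₀‖ ^ 2)| * ‖y - x₀‖ :=
            mul_le_mul_of_nonneg_left hk (abs_nonneg _)
        _ = |κ (‖y - x₀‖ ^ 2)| * ‖y - x₀‖ ^ 2 * ‖y - x₀‖⁻¹ := by field_simp
        _ ≤ 1 * ‖y - x₀‖⁻¹ := mul_le_mul_of_nonneg_right h1 (by positivity)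
        _ ≤ ρ₀⁻¹ := by rw [one_mul]; exact inv_anti₀ hρ₀ hyA.1.le
  have hWc : ∀ k : Fin 2, Continuous fun y : EuclideanSpace ℝ (Fin 2) => κ (‖y - x₀‖ ^ 2) * (y - x₀) k := fun k =>
    (hκc.comp (hnc.pow 2)).mul ((continuous_apply k).comp (PiLp.continuous_ofLp 2 _) |>.comp (continuous_id.sub continuous_const))
  have hWtop : ∀ k : Fin 2, MemLp (fun y : EuclideanSpace ℝ (Fin 2) => κ (‖y - x₀‖ ^ 2) * (y - x₀) k) ∞ ν := fun k =>
    memLp_top_of_bound (hWc k).aestronglyMeasurable (ρ₀⁻¹) (Filter.Eventually.of_forall fun y => by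
      rw [Real.norm_eq_abs]; exact hκbd y k)
  -- (4) px6's smooth bound for the cut-off approximants, rewritten on `A`
  have hP : ∀ m n, |∫ y, κ (‖y - x₀‖ ^ 2) * t m y * fderiv ℝ (s n) y (perp (y - x₀))| ≤
      Real.sqrt (∫ y in A, ‖fderiv ℝ (t m) y‖ ^ 2) * Real.sqrt (∫ y in A, ‖fderiv ℝ (s n) y‖ ^ 2) := by
    intro m n
    have h := abs_integral_radialWeight_mul_fderiv_perp_le (x₀ := x₀) hρ₀ hρ hκc hκ1 hκ0 (hT m) (hS n)
    have hL : (fun y => κ (‖y - x₀‖ ^ 2) * (θ y * t m y) * fderiv ℝ (fun y => θ y * s n y) y (perp (y - x₀))) =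
        fun y => κ (‖y - x₀‖ ^ 2) * t m y * fderiv ℝ (s n) y (perp (y - x₀)) := by
      funext y
      by_cases hy : κ (‖y - x₀‖ ^ 2) = 0
      · simp [hy]
      · have hyV := hAV (hκA y hy)
        rw [hfdS n y hyV, show θ y = 1 from hV1 hyV, one_mul]
    have hRa : ∫ y in A, ‖fderiv ℝ (fun y => θ y * t m y) y‖ ^ 2 = ∫ y in A, ‖fderiv ℝ (t m) y‖ ^ 2 :=
      setIntegral_congr_fun hAm fun y hy => by rw [hfdT m y (hAV hy)]
    have hRb : ∫ y in A, ‖fderiv ℝ (fun y => θ y * s n y) y‖ ^ 2 = ∫ y in A, ‖fderiv ℝ (s n) y‖ ^ 2 :=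
      setIntegral_congr_fun hAm fun y hy => by rw [hfdS n y (hAV hy)]
    rw [hL, hRa, hRb] at h
    exact h
  -- (5) energies on `A`: `∫_A ‖D s_n‖² → ∫_A ‖Gb‖²`, `∫_A ‖D t_m‖² → ∫_A ‖Ga‖²`
  have hE : ∀ {G : EuclideanSpace ℝ (Fin 2) → EuclideanSpace ℝ (Fin 2) →L[ℝ] ℝ} {f : ℕ → EuclideanSpace ℝ (Fin 2) → ℝ},
      (∀ w, MemLp (fun x => G x w) 2 ν) → (∀ n w, AEStronglyMeasurable (fun x => fderiv ℝ (f n) x w) ν) →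
      (∀ w, Tendsto (fun n => eLpNorm (fun x => G x w - fderiv ℝ (f n) x w) 2 ν) atTop (𝓝 0)) →
      Tendsto (fun n => Real.sqrt (∫ y in A, ‖fderiv ℝ (f n) y‖ ^ 2)) atTop (𝓝 (Real.sqrt (∫ y in A, ‖G y‖ ^ 2))) := by
    intro G f hG hfm hlim
    have hGA : ∀ w, MemLp (fun x => G x w) 2 νA := fun w => (hG w).mono_measure hνA_le
    have hfA : ∀ n w, AEStronglyMeasurable (fun x => fderiv ℝ (f n) x w) νA := fun n w => (hfm n w).mono_measure hνA_le
    have hlimA : ∀ w, Tendsto (fun n => eLpNorm (fun x => G x w - fderiv ℝ (f n) x w) 2 νA) atTop (𝓝 0) := fun w =>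
      tendsto_of_tendsto_of_tendsto_of_le_of_le tendsto_const_nhds (hlim w) (fun _ => bot_le)
        fun n => eLpNorm_mono_measure _ hνA_le
    have hk : ∀ k : Fin 2, Tendsto (fun n => ∫ y in A, (fderiv ℝ (f n) y (EuclideanSpace.single k (1:ℝ))) ^ 2) atTop
        (𝓝 (∫ y in A, (G y (EuclideanSpace.single k (1:ℝ))) ^ 2)) := fun k =>
      tendsto_integral_sq_of_L2 (ν := νA) (hGA _) (fun n => hfA n _) (hlimA _)
    have hev : ∀ k : Fin 2, ∀ᶠ n in atTop, MemLp (fun x => fderiv ℝ (f n) x (EuclideanSpace.single k (1:ℝ))) 2 νA := by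
      intro k
      have h1 : ∀ᶠ n in atTop, eLpNorm (fun x => G x (EuclideanSpace.single k (1:ℝ)) -
          fderiv ℝ (f n) x (EuclideanSpace.single k (1:ℝ))) 2 νA < 1 := (tendsto_order.1 (hlimA _)).2 1 zero_lt_one
      filter_upwards [h1] with n hn
      have hd : MemLp (fun x => G x (EuclideanSpace.single k (1:ℝ)) - fderiv ℝ (f n) x (EuclideanSpace.single k (1:ℝ))) 2 νA :=
        ⟨(hGA _).1.sub (hfA n _), hn.trans ENNReal.one_lt_top⟩
      exact ((hGA _).sub hd).congr_norm (hfA n _) (Filter.Eventually.of_forall fun x => by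
        simp only [Pi.sub_apply]; congr 1; ring)
    have hsum : ∀ᶠ n in atTop, ∫ y in A, ‖fderiv ℝ (f n) y‖ ^ 2 =
        ∑ k : Fin 2, ∫ y in A, (fderiv ℝ (f n) y (EuclideanSpace.single k (1:ℝ))) ^ 2 := by
      filter_upwards [hev 0, hev 1] with n h0 h1
      rw [← integral_finsetSum]
      · exact integral_congr_ae (Filter.Eventually.of_forall fun y => opNorm_sq_eq_sum_sq _)
      · intro k _
        fin_cases k
        · exact (memLp_two_iff_integrable_sq (hfA n _)).1 h0
        · exact (memLp_two_iff_integrable_sq (hfA n _)).1 h1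
    have hsumG : ∫ y in A, ‖G y‖ ^ 2 = ∑ k : Fin 2, ∫ y in A, (G y (EuclideanSpace.single k (1:ℝ))) ^ 2 := by
      rw [← integral_finsetSum]
      · exact integral_congr_ae (Filter.Eventually.of_forall fun y => opNorm_sq_eq_sum_sq _)
      · exact fun k _ => (memLp_two_iff_integrable_sq (hGA _).1).1 (hGA _)
    have hT : Tendsto (fun n => ∑ k : Fin 2, ∫ y in A, (fderiv ℝ (f n) y (EuclideanSpace.single k (1:ℝ))) ^ 2) atTop
        (𝓝 (∑ k : Fin 2, ∫ y in A, (G y (EuclideanSpace.single k (1:ℝ))) ^ 2)) :=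
      tendsto_finsetSum _ fun k _ => hk k
    rw [hsumG]
    exact ((hT.congr' (hsum.mono fun n hn => hn.symm)).sqrt)
  have hEb := hE hGbL2 hsm hDb
  have hEa := hE hGaL2 htm' hDa
  -- (6) the limit in `n` (fixed `m` with `t m ∈ L²`)
  have hIm : ∀ᶠ m in atTop, |∫ y, κ (‖y - x₀‖ ^ 2) * t m y * Gb y (perp (y - x₀))| ≤
      Real.sqrt (∫ y in A, ‖fderiv ℝ (t m) y‖ ^ 2) * Real.sqrt (∫ y in A, ‖Gb y‖ ^ 2) := by
    filter_upwards [htev] with m htm2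
    have ha₁ : MemLp (fun y => t m y * (κ (‖y - x₀‖ ^ 2) * (y - x₀) 0)) 2 ν := MemLp.mul' (r := 2) (hWtop 0) htm2
    have ha₂ : MemLp (fun y => t m y * (κ (‖y - x₀‖ ^ 2) * (y - x₀) 1)) 2 ν := MemLp.mul' (r := 2) (hWtop 1) htm2
    have hlimn := tendsto_integral_mul_sub_mul_of_L2 (ν := ν) ha₁ ha₂ (hGbL2 (EuclideanSpace.single 1 (1:ℝ)))
      (hGbL2 (EuclideanSpace.single 0 (1:ℝ))) (fun n => hsm n _) (fun n => hsm n _) (hDb _) (hDb _)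
    have hid : ∀ (L : EuclideanSpace ℝ (Fin 2) → EuclideanSpace ℝ (Fin 2) →L[ℝ] ℝ) (y : EuclideanSpace ℝ (Fin 2)),
        t m y * (κ (‖y - x₀‖ ^ 2) * (y - x₀) 0) * L y (EuclideanSpace.single 1 (1:ℝ)) -
        t m y * (κ (‖y - x₀‖ ^ 2) * (y - x₀) 1) * L y (EuclideanSpace.single 0 (1:ℝ)) =
        κ (‖y - x₀‖ ^ 2) * t m y * L y (perp (y - x₀)) := by
      intro L y; rw [apply_perp_eq]; ring
    have hzero : ∀ (L : EuclideanSpace ℝ (Fin 2) → EuclideanSpace ℝ (Fin 2) →L[ℝ] ℝ),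
        ∫ y in (Ω' : Set (EuclideanSpace ℝ (Fin 2))), κ (‖y - x₀‖ ^ 2) * t m y * L y (perp (y - x₀)) =
          ∫ y, κ (‖y - x₀‖ ^ 2) * t m y * L y (perp (y - x₀)) := by
      intro L
      refine setIntegral_eq_integral_of_forall_compl_eq_zero fun y hy => ?_
      have : κ (‖y - x₀‖ ^ 2) = 0 := by
        by_contra h; exact hy (hAΩ (hκA y h))
      rw [this]; ring
    have hlimn' : Tendsto (fun n => ∫ y, κ (‖y - x₀‖ ^ 2) * t m y * fderiv ℝ (s n) y (perp (y - x₀))) atTop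
        (𝓝 (∫ y, κ (‖y - x₀‖ ^ 2) * t m y * Gb y (perp (y - x₀)))) := by
      have h1 : (fun n => ∫ y, (t m y * (κ (‖y - x₀‖ ^ 2) * (y - x₀) 0) * fderiv ℝ (s n) y (EuclideanSpace.single 1 (1:ℝ)) -
          t m y * (κ (‖y - x₀‖ ^ 2) * (y - x₀) 1) * fderiv ℝ (s n) y (EuclideanSpace.single 0 (1:ℝ))) ∂ν) =
          fun n => ∫ y, κ (‖y - x₀‖ ^ 2) * t m y * fderiv ℝ (s n) y (perp (y - x₀)) := by
        funext n
        rw [hν, integral_congr_ae (Filter.Eventually.of_forall fun y => hid (fun y => fderiv ℝ (s n) y) y)]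
        exact hzero (fun y => fderiv ℝ (s n) y)
      have h2 : ∫ y, (t m y * (κ (‖y - x₀‖ ^ 2) * (y - x₀) 0) * Gb y (EuclideanSpace.single 1 (1:ℝ)) -
          t m y * (κ (‖y - x₀‖ ^ 2) * (y - x₀) 1) * Gb y (EuclideanSpace.single 0 (1:ℝ))) ∂ν =
          ∫ y, κ (‖y - x₀‖ ^ 2) * t m y * Gb y (perp (y - x₀)) := by
        rw [hν, integral_congr_ae (Filter.Eventually.of_forall fun y => hid Gb y)]
        exact hzero Gb
      rw [h1, h2] at hlimn
      exact hlimn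
    exact le_of_tendsto_of_tendsto' hlimn'.abs (tendsto_const_nhds.mul hEb |>.congr fun n => by rfl)
      fun n => hP m n
  -- (7) the limit in `m`
  have hF : MemLp (fun y => κ (‖y - x₀‖ ^ 2) * Gb y (perp (y - x₀))) 2 ν := by
    have h1 : MemLp (fun y => Gb y (EuclideanSpace.single 1 (1:ℝ)) * (κ (‖y - x₀‖ ^ 2) * (y - x₀) 0)) 2 ν :=
      MemLp.mul' (r := 2) (hWtop 0) (hGbL2 _)
    have h2 : MemLp (fun y => Gb y (EuclideanSpace.single 0 (1:ℝ)) * (κ (‖y - x₀‖ ^ 2) * (y - x₀) 1)) 2 ν :=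
      MemLp.mul' (r := 2) (hWtop 1) (hGbL2 _)
    refine (h1.sub h2).ae_eq (Filter.Eventually.of_forall fun y => ?_)
    simp only [Pi.sub_apply]
    rw [apply_perp_eq]
    ring
  obtain ⟨-, hlimm⟩ := tendsto_integral_mul_of_L2 (ν := ν) hF haL2 htm hta
  have hlimm' : Tendsto (fun m => ∫ y, κ (‖y - x₀‖ ^ 2) * t m y * Gb y (perp (y - x₀))) atTop
      (𝓝 (∫ y, κ (‖y - x₀‖ ^ 2) * a y * Gb y (perp (y - x₀)))) := by
    have hz : ∀ f : EuclideanSpace ℝ (Fin 2) → ℝ,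
        ∫ y, κ (‖y - x₀‖ ^ 2) * Gb y (perp (y - x₀)) * f y ∂ν = ∫ y, κ (‖y - x₀‖ ^ 2) * f y * Gb y (perp (y - x₀)) := by
      intro f
      rw [hν, integral_congr_ae (Filter.Eventually.of_forall fun y =>
        (show κ (‖y - x₀‖ ^ 2) * Gb y (perp (y - x₀)) * f y = κ (‖y - x₀‖ ^ 2) * f y * Gb y (perp (y - x₀)) by ring))]
      refine setIntegral_eq_integral_of_forall_compl_eq_zero fun y hy => ?_
      have : κ (‖y - x₀‖ ^ 2) = 0 := by
        by_contra h; exact hy (hAΩ (hκA y h))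
      rw [this]; ring
    have h1 : (fun m => ∫ y, κ (‖y - x₀‖ ^ 2) * Gb y (perp (y - x₀)) * t m y ∂ν) =
        fun m => ∫ y, κ (‖y - x₀‖ ^ 2) * t m y * Gb y (perp (y - x₀)) := funext fun m => hz (t m)
    rw [h1, hz a] at hlimm
    exact hlimm
  exact le_of_tendsto_of_tendsto hlimm'.abs (hEa.mul tendsto_const_nhds) hIm

end Summit.QuantumFields.YangMills.Theorems.PoincareLipschitzWenteOneCentreBound

end
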